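import Summits.Ventures.CertifiedManyBodySolver.Observables.StiffnessApexTransportThermal
import Literature.MathematicalPhysics.QuantumLattice.HubbardTTPrimeApexRowGroundToThermal
import HarnessLib

/-!
# Ventures/CertifiedManyBodySolver — Observables/StiffnessApexTransportThermalFromGround.lean

HONEST FRAMING: one-sided certified CEILINGS on the THERMAL uniform flux stiffness (t–t′ f-sum class) at ONE inverse temperature,
obtained from `T = 0` source rows by the GROUND → THERMAL apex row; conditional BY NAME on the `T = 0` source row; the only loss is the
explicit entropy price `U_A·s_∞(n)/(4β(U_P − U_A))`, `s_∞(n) = 2H_b(n/2) ≤ log 4`, which makes every word loose at `T ≳ 0.1 t` and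
useless for a KT bound on `T_c` below the kinematic one; a ceiling never speaks to the presence of order; CONTROL / CALIBRATION class;
not a superconductivity verdict; no phase sentence. Zero compute, no definition, no claim node, no `sorry`.

Cell `pub/hubbard-downfold` (D-0096 (2) / D-0099: the phase map's cells are `T × couplings`; D-0150 L-DF2 «box ↦ one word»), seat
`hubbard-downfold-unc-2` (`prover-hubbard-downfold-unc-2-g18-0`); the `T = 0`-SOURCE / `T > 0`-TARGET companion of
`StiffnessApexTransport` (both `T = 0`) and `StiffnessApexTransportThermal` (both thermal, ray `βU = const`), built on
`Literature/…/HubbardTTPrimeApexRowGroundToThermal`: for a torus limit `ω_A` of sector GROUND states at `A = (t′_A, U_A, n)` and a torus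
limit `ω_P` of the canonical sector GIBBS states at `P = (β; t′_P, U_P, n)`, `0 ≤ U_A < U_P`,
`e_{Φ(1,κ,0)}(ω_A) ≤ e_{Φ(1,κ,0)}(ω_P) + U_A·s_∞(n)/(β(U_P − U_A))`, `κ = (U_P t′_A − U_A t′_P)/(U_P − U_A)` (`U_P ×` the cut row at `A` plus
`U_A ×` the universal energy–entropy cap at `P`; the double occupancy cancels). With the thermal f-sum dictionary
`Re ω(k₀^{tt′}) = −½ e_{Φ(1,2t′,0)}(ω)` (`re_expect_kinBondObsTT_eq_of_isD4Invariant`; thermal torus limits are `D₄`-invariant):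

* §1 POINT: a `T = 0` floor `ℓ ≤ e_{Φ(1,2t′_P,0)}` on the GROUND-STATE class at the apex source `A` (`U_P t′_A = (2U_P − U_A) t′_P`) ⇒
  `ObsThermalStiffnessSeqCeilingAtBeta t′_P U_P n β c` for every `β > 0` and every `c ≥ −ℓ/4 + U_A·2H_b(n/2)/(4β(U_P − U_A))`
  (`…_of_groundApexSource_floor`; `log 4` edition `…_floor_log_four`); the same from a `T = 0` orbit-LOWER ROW for the target-slot
  objective `−X₀(t′_P)` at the source (`…_of_groundApexSource_orbitLowerRow`: the shape `SquareTTPrimeCorrOrbitLowerRow` of every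
  stiffness claim node of record, `c ≥ −r + price/4`; `…_orbitLower`: the discharged orbit-mean sentence of a point node); the `t′ = 0` ray from a `T = 0` kinetic floor (`…_tp0_of_groundKinetic_floor`);
* §2 LEFT EDGE from a corner-objective ROW FAMILY: sources `(s, U_A)`, `s ∈ [s₁, s₂]`, all certified for the objective `−X₀(σ)` (an
  «overhang row» / target-slot bundle of record, `TPrimeBundleOrbitLowerRow.orbitLower` output shape) ⇒ the thermal leaf at every point
  `(σ, U_P)` of the edge segment `U_P ∈ [U_lo, U_hi]` whose apex source `σ(2 − U_A/U_P)` lies in `[s₁, s₂]`, with ONE constant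
  `c ≥ −F + U_A·2H_b(n/2)/(4β(U_lo − U_A))` (`…_on_leftEdge_of_cornerObjectiveOrbitLower`);
* §3 KT closure (`ThermalKTDictionaryAt.le_inv_of_leafAtBeta`): `(π/4)c < 1/β ⇒ T_c(U_P) ≤ 1/β`, recorded for completeness — sized
  honestly: at cuprate couplings the price exceeds the certified `T = 0` suppression, so this never beats the kinematic KT word.

NOT said: nothing toward smaller `U` or at `U_P = U_A`; no `∀β` leaf with a `β`-free constant (the constant is `c₀ + γ/β`); the
half-filling hinge `t′K₂ ≤ 0` for thermal states is not used (own-word sources need it; corner-objective / target-slot sources do not).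

References: D. Ruelle, *Statistical Mechanics* (1969) §2.5 [Ruelle1969]; T. Koma, H. Tasaki, J. Stat. Phys. 76 (1994) 745, §1 [KomaTasaki1994];
T. Hazra, N. Verma, M. Randeria, PRX 9 (2019) 031049, eqs. (2)–(4) [HazraVermaRanderia2019]; D. J. Scalapino, S. R. White, S.-C. Zhang,
PRB 47 (1993) 7995, §II [ScalapinoWhiteZhang1993].
-/

noncomputable section

namespace Summit.Ventures.CertifiedManyBodySolver.Observables

open Filter Topology Matrix Finset
open Literature.MathematicalPhysics.QuantumLattice
open Literature.MathematicalPhysics.QuantumLattice.InfVolFermionState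
open Literature.MathematicalPhysics.QuantumLattice.ThermodynamicLimit
open Literature.MathematicalPhysics.QuantumFieldTheory
open Literature.MathematicalPhysics.StatisticalMechanics
open Literature.MathematicalPhysics.StatisticalMechanics.KosterlitzThouless
open Literature.Probability.LatticeModels
open scoped ComplexConjugate ComplexOrder

/-! ## §1 Point transport: a `T = 0` word at the apex source is a thermal stiffness ceiling at the target -/

section Point

variable {t'A UA t'P UP β n : ℝ}

/-- **GROUND → THERMAL APEX TRANSPORT OF THE f-SUM STIFFNESS CEILING.** `0 ≤ n < 2`, `0 ≤ U_A < U_P`, `0 < β`, and the source on the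
target's apex segment: `U_P t′_A = (2U_P − U_A) t′_P`. If `ℓ ≤ e_{Φ(1,2t′_P,0)}(ω_A)` for EVERY torus limit `ω_A` of unit `(rectN n L, S^z = 0)`-sector
GROUND states of `hubbardTorusTT' L 1 t′_A U_A` (a `T = 0` certified FLOOR on the doubled-hopping energy — the shape of an f-sum word for the
TARGET's objective), then `ObsThermalStiffnessSeqCeilingAtBeta t′_P U_P n β c` for every `c ≥ −ℓ/4 + U_A·(2H_b(n/2)/β)/(U_P − U_A)/4`.
[cite: Ruelle1969, §2.5] [cite: KomaTasaki1994, §1] [cite: HazraVermaRanderia2019, eq. (4)] -/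
theorem ObsThermalStiffnessSeqCeilingAtBeta_of_groundApexSource_floor (hn0 : 0 ≤ n) (hn2 : n < 2) (hβ : 0 < β) (hUA : 0 ≤ UA)
    (hU : UA < UP) (hapex : UP * t'A = (2 * UP - UA) * t'P) {ℓ : ℝ}
    (hℓ : ∀ (ωA : InfVolFermionState 2) (LsA : ℕ → ℕ) (ψA : ∀ L, Fock (Orb (FermionTorus 2 L))),
      Tendsto LsA atTop atTop →
      (∀ j, IsGroundStateInSector (hubbardTorusTT' (LsA j) 1 t'A UA) (rectN n (LsA j)) 0 (ψA (LsA j))) →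
      (∀ j, star (ψA (LsA j)) ⬝ᵥ ψA (LsA j) = 1) → ωA.IsTorusLimitOf ψA LsA →
      ℓ ≤ ωA.meanEnergy (hubbardTTPrimeFermionInteraction 1 (2 * t'P) 0) 1)
    (c : ℚ) (hc : -ℓ / 4 + UA * (2 * Real.binEntropy (n / 2) / β) / (UP - UA) / 4 ≤ ((c : ℚ) : ℝ)) :
    ObsThermalStiffnessSeqCeilingAtBeta t'P UP n β c := by
  refine ObsThermalStiffnessSeqCeilingAtBeta_of_torusLimit_kinetic_le hβ hn0 hn2.le fun ω Ls hLs hω => ?_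
  have hfl := IsTorusLimitOfMixture.le_meanEnergy_twice_tPrime_thermal_of_forall_groundSource 1 hUA hU hapex hn0 hn2 hβ hℓ hω hLs
  rw [re_expect_kinBondObsTT_eq_of_isD4Invariant hω.isTranslationInvariant (hω.isD4Invariant_of_sectorGibbs 1 t'P UP n β hLs) t'P]
  have hco := InfVolFermionState.meanEnergy_hubbardTTPrime_eq_coords ω 1 (2 * t'P) 0
  rw [one_mul, zero_mul, add_zero] at hco
  rw [← hco]
  linarith

/-- **The `log 4` edition** (density-free entropy constant): same hypotheses, `c ≥ −ℓ/4 + U_A·(log 4/β)/(U_P − U_A)/4`.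
[cite: Ruelle1969, §2.5] [cite: KomaTasaki1994, §1] [cite: HazraVermaRanderia2019, eq. (4)] -/
theorem ObsThermalStiffnessSeqCeilingAtBeta_of_groundApexSource_floor_log_four (hn0 : 0 ≤ n) (hn2 : n < 2) (hβ : 0 < β)
    (hUA : 0 ≤ UA) (hU : UA < UP) (hapex : UP * t'A = (2 * UP - UA) * t'P) {ℓ : ℝ}
    (hℓ : ∀ (ωA : InfVolFermionState 2) (LsA : ℕ → ℕ) (ψA : ∀ L, Fock (Orb (FermionTorus 2 L))),
      Tendsto LsA atTop atTop →
      (∀ j, IsGroundStateInSector (hubbardTorusTT' (LsA j) 1 t'A UA) (rectN n (LsA j)) 0 (ψA (LsA j))) →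
      (∀ j, star (ψA (LsA j)) ⬝ᵥ ψA (LsA j) = 1) → ωA.IsTorusLimitOf ψA LsA →
      ℓ ≤ ωA.meanEnergy (hubbardTTPrimeFermionInteraction 1 (2 * t'P) 0) 1)
    (c : ℚ) (hc : -ℓ / 4 + UA * (Real.log 4 / β) / (UP - UA) / 4 ≤ ((c : ℚ) : ℝ)) :
    ObsThermalStiffnessSeqCeilingAtBeta t'P UP n β c := by
  refine ObsThermalStiffnessSeqCeilingAtBeta_of_groundApexSource_floor hn0 hn2 hβ hUA hU hapex hℓ c (le_trans ?_ hc)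
  have hd : 0 < UP - UA := sub_pos.2 hU
  have hs : 2 * Real.binEntropy (n / 2) ≤ Real.log 4 := by
    have h := Real.binEntropy_le_log_two (p := n / 2)
    have h4 : Real.log 4 = 2 * Real.log 2 := by
      rw [show (4 : ℝ) = 2 ^ 2 by norm_num, Real.log_pow]; norm_num
    linarith
  have h1 : UA * (2 * Real.binEntropy (n / 2) / β) ≤ UA * (Real.log 4 / β) :=
    mul_le_mul_of_nonneg_left (div_le_div_of_nonneg_right hs hβ.le) hUA
  have h2 := div_le_div_of_nonneg_right (div_le_div_of_nonneg_right h1 hd.le) (by norm_num : (0 : ℝ) ≤ 4)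
  linarith

/-- **From a `T = 0` orbit LOWER ROW at the source for the TARGET's f-sum operator** (the claim-node shape of record). Same geometry;
if the source certificate at `(t′_A, U_A, n)` carries `r ≤ |D₄|⁻¹ Σ_γ Re ω_γ(−X₀(t′_P))` (target-slot objective, any `U`-slot `Uo`) on the
ground-state class under its cap `e(1,t′_A,U_A,n) ≤ u`, and the cap is certified, then `ObsThermalStiffnessSeqCeilingAtBeta t′_P U_P n β c` for
every `β > 0` and every `c ≥ −r + U_A·(2H_b(n/2)/β)/(U_P − U_A)/4`. [cite: KomaTasaki1994, §1] [cite: ScalapinoWhiteZhang1993, §II] -/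
theorem ObsThermalStiffnessSeqCeilingAtBeta_of_groundApexSource_orbitLowerRow (Uo : ℝ) (hn0 : 0 ≤ n) (hn2 : n < 2)
    (hβ : 0 < β) (hUA : 0 ≤ UA) (hU : UA < UP) (hapex : UP * t'A = (2 * UP - UA) * t'P) {u r : ℚ}
    (hrow : SquareTTPrimeCorrOrbitLowerRow t'A UA n u r Finset.univ (box 2 7) (-oddMomentObsTT t'P Uo 0))
    (hu : energyDensityTT' 1 t'A UA n ≤ ((u : ℚ) : ℝ)) (c : ℚ)
    (hc : -((r : ℚ) : ℝ) + UA * (2 * Real.binEntropy (n / 2) / β) / (UP - UA) / 4 ≤ ((c : ℚ) : ℝ)) :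
    ObsThermalStiffnessSeqCeilingAtBeta t'P UP n β c := by
  refine ObsThermalStiffnessSeqCeilingAtBeta_of_groundApexSource_floor hn0 hn2 hβ hUA hU hapex (ℓ := 4 * ((r : ℚ) : ℝ))
    (fun ω Ls ψ hLs hψ h1 hω => ?_) c (by linarith)
  have h := hrow ω Ls ψ hLs hψ h1 hω hu
  rw [orbitMean_re_expect_neg_oddMomentTT_lam_zero hω.isTranslationInvariant] at h
  linarith

/-- **From a `T = 0` orbit-mean FAMILY SENTENCE at the source** (the reading shape of a discharged point node:
`F ≤ |D₄|⁻¹ Σ_γ Re ω_γ(−X₀(t′_P))` for every torus-limit ground state of the source class, window already discharged — e.g.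
`laBoxE_stiffF0om3o10_…_cornerObjective_pointLowerBound_of`, `…_slotWord_of`). Same geometry ⇒ `ObsThermalStiffnessSeqCeilingAtBeta t′_P U_P n β c`
for every `β > 0` and every `c ≥ −F + U_A·(2H_b(n/2)/β)/(U_P − U_A)/4`. [cite: KomaTasaki1994, §1] [cite: ScalapinoWhiteZhang1993, §II] -/
theorem ObsThermalStiffnessSeqCeilingAtBeta_of_groundApexSource_orbitLower (Uo : ℝ) (hn0 : 0 ≤ n) (hn2 : n < 2)
    (hβ : 0 < β) (hUA : 0 ≤ UA) (hU : UA < UP) (hapex : UP * t'A = (2 * UP - UA) * t'P) {F : ℚ}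
    (horb : ∀ (ω : InfVolFermionState 2) (Ls : ℕ → ℕ) (ψ : ∀ L, Fock (Orb (FermionTorus 2 L))),
      Tendsto Ls atTop atTop →
      (∀ j, IsGroundStateInSector (hubbardTorusTT' (Ls j) 1 t'A UA) (rectN n (Ls j)) 0 (ψ (Ls j))) →
      (∀ j, star (ψ (Ls j)) ⬝ᵥ ψ (Ls j) = 1) → ω.IsTorusLimitOf ψ Ls →
      ((F : ℚ) : ℝ) ≤ ((Finset.univ : Finset (DihedralGroup 4)).card : ℝ)⁻¹ * ∑ g ∈ (Finset.univ : Finset (DihedralGroup 4)),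
        (ω.expect (d4ShiftSet g 0 (box 2 7)) (fermionEmbed (PolySite.d4Emb g 0 (box 2 7)) (-oddMomentObsTT t'P Uo 0))).re)
    (c : ℚ) (hc : -((F : ℚ) : ℝ) + UA * (2 * Real.binEntropy (n / 2) / β) / (UP - UA) / 4 ≤ ((c : ℚ) : ℝ)) :
    ObsThermalStiffnessSeqCeilingAtBeta t'P UP n β c := by
  refine ObsThermalStiffnessSeqCeilingAtBeta_of_groundApexSource_floor hn0 hn2 hβ hUA hU hapex (ℓ := 4 * ((F : ℚ) : ℝ))
    (fun ω Ls ψ hLs hψ h1 hω => ?_) c (by linarith)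
  have h := horb ω Ls ψ hLs hψ h1 hω
  rw [orbitMean_re_expect_neg_oddMomentTT_lam_zero hω.isTranslationInvariant] at h
  linarith

/-- **The `t′ = 0` ray from a `T = 0` kinetic floor**: `0 ≤ n < 2`, `0 ≤ U_A < U_P`, `β > 0`; if `ℓ ≤ e_{Φ(1,0,0)}(ω_A)` (kinetic energy per
site) for every torus limit of unit sector ground states of `hubbardTorusTT' L 1 0 U_A` at density `n` (any `T = 0` kinetic certificate of
record at `(U_A, n, t′ = 0)`), then `ObsThermalStiffnessSeqCeilingAtBeta 0 U_P n β c` for every `c ≥ −ℓ/4 + U_A·(2H_b(n/2)/β)/(U_P − U_A)/4` — a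
`T = 0` kinetic word is a thermal stiffness ceiling at every LARGER coupling and every temperature. [cite: Ruelle1969, §2.5] [cite: HazraVermaRanderia2019, eq. (4)] -/
theorem ObsThermalStiffnessSeqCeilingAtBeta_tp0_of_groundKinetic_floor {UA UP β n : ℝ} (hn0 : 0 ≤ n) (hn2 : n < 2) (hβ : 0 < β)
    (hUA : 0 ≤ UA) (hU : UA < UP) {ℓ : ℝ}
    (hℓ : ∀ (ωA : InfVolFermionState 2) (LsA : ℕ → ℕ) (ψA : ∀ L, Fock (Orb (FermionTorus 2 L))),
      Tendsto LsA atTop atTop →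
      (∀ j, IsGroundStateInSector (hubbardTorusTT' (LsA j) 1 0 UA) (rectN n (LsA j)) 0 (ψA (LsA j))) →
      (∀ j, star (ψA (LsA j)) ⬝ᵥ ψA (LsA j) = 1) → ωA.IsTorusLimitOf ψA LsA →
      ℓ ≤ ωA.meanEnergy (hubbardTTPrimeFermionInteraction 1 0 0) 1)
    (c : ℚ) (hc : -ℓ / 4 + UA * (2 * Real.binEntropy (n / 2) / β) / (UP - UA) / 4 ≤ ((c : ℚ) : ℝ)) :
    ObsThermalStiffnessSeqCeilingAtBeta 0 UP n β c := by
  refine ObsThermalStiffnessSeqCeilingAtBeta_of_groundApexSource_floor (t'A := 0) (t'P := 0) hn0 hn2 hβ hUA hU (by ring)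
    (ℓ := ℓ) (fun ω Ls ψ hLs hψ h1 hω => ?_) c hc
  simpa only [mul_zero] using hℓ ω Ls ψ hLs hψ h1 hω

end Point

/-! ## §2 The left edge of a box from ONE corner-objective row family (overhang / target-slot bundle of record) -/

section LeftEdge

variable {σ UA Ulo Uhi s₁ s₂ β n : ℝ}

/-- **Apex source of the left-edge point `(σ, U_P)`**: the source `σ(2 − U_A/U_P)` lies on the segment from the apex `(2σ, 0)` to `(σ, U_P)`:
`U_P·(σ(2 − U_A/U_P)) = (2U_P − U_A)·σ` (`U_P ≠ 0`). [folklore] -/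
theorem leftEdge_apexSource_eq {UP : ℝ} (hUP : UP ≠ 0) (σ UA : ℝ) :
    UP * (σ * (2 - UA / UP)) = (2 * UP - UA) * σ := by
  field_simp

/-- **The apex source is monotone along the edge** (`σ ≤ 0`, `0 ≤ U_A`, `0 < U_P ≤ U_P'`): `σ(2 − U_A/U_P') ≤ σ(2 − U_A/U_P)` — higher targets
read from sources further out. [folklore] -/
theorem leftEdge_apexSource_anti {UP UP' : ℝ} (hσ : σ ≤ 0) (hUA : 0 ≤ UA) (hUP : 0 < UP) (hle : UP ≤ UP') :
    σ * (2 - UA / UP') ≤ σ * (2 - UA / UP) := by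
  have h : UA / UP' ≤ UA / UP := div_le_div_of_nonneg_left hUA hUP hle
  nlinarith

/-- **THE LEFT EDGE FROM ONE CORNER-OBJECTIVE ROW FAMILY, thermally.** `σ ≤ 0` (the edge hopping), `0 ≤ n < 2`, `0 < β`, a source station
`0 ≤ U_A < U_lo`, an edge segment `[U_lo, U_hi]`, and a `T = 0` orbit-lower family for the FIXED objective `−X₀(σ)` (any `U`-slot `Uo`) with value `F` on the ground-state
classes at `(s, U_A, n)`, `s ∈ [s₁, s₂]` (the `TPrimeBundleOrbitLowerRow.orbitLower` output of a corner-objective bundle once floor and cap are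
discharged). If the edge segment's sources lie in the family, `s₁ ≤ σ(2 − U_A/U_hi)` and `σ(2 − U_A/U_lo) ≤ s₂`, then for every `U_P ∈ [U_lo, U_hi]`:
`ObsThermalStiffnessSeqCeilingAtBeta σ U_P n β c` with ONE constant `c ≥ −F + U_A·(2H_b(n/2)/β)/(U_lo − U_A)/4` (the price is largest at the
bottom of the segment). [cite: KomaTasaki1994, §1] [cite: ScalapinoWhiteZhang1993, §II] [cite: Ruelle1969, §2.5] -/
theorem ObsThermalStiffnessSeqCeilingAtBeta_on_leftEdge_of_cornerObjectiveOrbitLower (Uo : ℝ) (hσ : σ ≤ 0) (hn0 : 0 ≤ n)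
    (hn2 : n < 2) (hβ : 0 < β) (hUA : 0 ≤ UA) (hlo : UA < Ulo)
    (hs₁ : s₁ ≤ σ * (2 - UA / Uhi)) (hs₂ : σ * (2 - UA / Ulo) ≤ s₂) {F : ℚ}
    (hrows : ∀ s ∈ Set.Icc s₁ s₂, ∀ (ω : InfVolFermionState 2) (Ls : ℕ → ℕ) (ψ : ∀ L, Fock (Orb (FermionTorus 2 L))),
      Tendsto Ls atTop atTop →
      (∀ j, IsGroundStateInSector (hubbardTorusTT' (Ls j) 1 s UA) (rectN n (Ls j)) 0 (ψ (Ls j))) →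
      (∀ j, star (ψ (Ls j)) ⬝ᵥ ψ (Ls j) = 1) → ω.IsTorusLimitOf ψ Ls →
      ((F : ℚ) : ℝ) ≤ ((Finset.univ : Finset (DihedralGroup 4)).card : ℝ)⁻¹ * ∑ g ∈ (Finset.univ : Finset (DihedralGroup 4)),
        (ω.expect (d4ShiftSet g 0 (box 2 7)) (fermionEmbed (PolySite.d4Emb g 0 (box 2 7)) (-oddMomentObsTT σ Uo 0))).re)
    (c : ℚ) (hc : -((F : ℚ) : ℝ) + UA * (2 * Real.binEntropy (n / 2) / β) / (Ulo - UA) / 4 ≤ ((c : ℚ) : ℝ)) :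
    ∀ UP ∈ Set.Icc Ulo Uhi, ObsThermalStiffnessSeqCeilingAtBeta σ UP n β c := by
  intro UP hUP
  have hUlo : 0 < Ulo := hUA.trans_lt hlo
  have hUP0 : 0 < UP := hUlo.trans_le hUP.1
  have hU : UA < UP := hlo.trans_le hUP.1
  -- the source of `(σ, U_P)` lies in the certified family
  have hmem : σ * (2 - UA / UP) ∈ Set.Icc s₁ s₂ :=
    ⟨hs₁.trans (leftEdge_apexSource_anti hσ hUA hUP0 hUP.2),
     (leftEdge_apexSource_anti hσ hUA hUlo hUP.1).trans hs₂⟩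
  -- the price at `U_P` is at most the price at `U_lo`
  have hent : 0 ≤ 2 * Real.binEntropy (n / 2) / β :=
    div_nonneg (mul_nonneg (by norm_num) (Real.binEntropy_nonneg (by linarith) (by linarith))) hβ.le
  have hprice : UA * (2 * Real.binEntropy (n / 2) / β) / (UP - UA) / 4 ≤
      UA * (2 * Real.binEntropy (n / 2) / β) / (Ulo - UA) / 4 :=
    div_le_div_of_nonneg_right
      (div_le_div_of_nonneg_left (mul_nonneg hUA hent) (sub_pos.2 hlo) (by linarith [hUP.1])) (by norm_num)
  refine ObsThermalStiffnessSeqCeilingAtBeta_of_groundApexSource_floor hn0 hn2 hβ hUA hU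
    (leftEdge_apexSource_eq hUP0.ne' σ UA) (ℓ := 4 * ((F : ℚ) : ℝ)) (fun ω Ls ψ hLs hψ h1 hω => ?_) c (by linarith)
  have h := hrows _ hmem ω Ls ψ hLs hψ h1 hω
  rw [orbitMean_re_expect_neg_oddMomentTT_lam_zero hω.isTranslationInvariant] at h
  linarith

end LeftEdge

/-! ## §3 KT closure (recorded; see the honest sizing in the header) -/

section KT

open Real

variable {t'A UA t'P UP β n : ℝ} {ρe : ℝ → ℝ} {Tc : ℝ}

/-- **`T_KT` at the target from a `T = 0` source word.** With the KT dictionary at `(U_P, n, t′_P)`, the ground → thermal leaf of §1 fed by a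
`T = 0` source floor `ℓ` at the apex source, and `(π/4)·c < 1/β` for some admissible `c ≥ −ℓ/4 + U_A·(2H_b(n/2)/β)/(U_P − U_A)/4`: `Tc ≤ 1/β`.
Monotonicity-free; conditional on the dictionary; never below the kinematic KT word at cuprate couplings (header). [cite: HazraVermaRanderia2019, eqs. (2)–(3)] -/
theorem ThermalKTDictionaryAt.le_inv_of_groundApexSource_floor (hT : ThermalKTDictionaryAt t'P UP n ρe Tc) (hn0 : 0 ≤ n)
    (hn2 : n < 2) (hβ : 0 < β) (hUA : 0 ≤ UA) (hU : UA < UP) (hapex : UP * t'A = (2 * UP - UA) * t'P) {ℓ : ℝ}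
    (hℓ : ∀ (ωA : InfVolFermionState 2) (LsA : ℕ → ℕ) (ψA : ∀ L, Fock (Orb (FermionTorus 2 L))),
      Tendsto LsA atTop atTop →
      (∀ j, IsGroundStateInSector (hubbardTorusTT' (LsA j) 1 t'A UA) (rectN n (LsA j)) 0 (ψA (LsA j))) →
      (∀ j, star (ψA (LsA j)) ⬝ᵥ ψA (LsA j) = 1) → ωA.IsTorusLimitOf ψA LsA →
      ℓ ≤ ωA.meanEnergy (hubbardTTPrimeFermionInteraction 1 (2 * t'P) 0) 1)
    (c : ℚ) (hc : -ℓ / 4 + UA * (2 * Real.binEntropy (n / 2) / β) / (UP - UA) / 4 ≤ ((c : ℚ) : ℝ))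
    (hlt : π / 4 * ((c : ℚ) : ℝ) < 1 / β) : Tc ≤ 1 / β :=
  hT.le_inv_of_leafAtBeta hβ
    (ObsThermalStiffnessSeqCeilingAtBeta_of_groundApexSource_floor hn0 hn2 hβ hUA hU hapex hℓ c hc) hlt

end KT

end Summit.Ventures.CertifiedManyBodySolver.Observables

end
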